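import Mathlib.RingTheory.LocalProperties.Basic
import Mathlib.RingTheory.Ideal.Quotient.Operations
import Mathlib.RingTheory.Ideal.Maps
import Mathlib.RingTheory.Localization.Away.Basic
import Mathlib.RingTheory.Localization.Ideal
import Mathlib.LinearAlgebra.Quotient.Basic
import HarnessLib

/-!
# The local seesaw datum: two represented trivialisation functors and the ideal `I + I′`

[MumfordAV1970] §10 (p. 89), the commutative algebra of the LOCAL step of the seesaw theorem in scheme form
([GortzWedhorn2023] Thm. 24.66): over a chart ring `A` the functors `B ↦ H⁰(X_B, L_B)` and `B ↦ H⁰(X_B, L_B⁻¹)` are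
represented by `B ↦ Ann_B(I·B)` and `B ↦ Ann_B(I′·B)`, «`L_B` trivial» means «both annihilators are free of rank one on
a generator pairing to a unit», and then «`L_B` trivial ⟺ (I + I′)·B = 0». This file isolates that algebra:
* §1 `isUnit_of_forall_maximal_image_ne_zero`; §2 linear-algebra lemmas (`Ideal.eq_bot_of_annihilator_linearEquiv`,
  `Ideal.eq_bot_of_forall_maximal_away`: an ideal whose annihilator is free of rank one near every maximal ideal is `0`);
* §3 the structure `LocalSeesawDatum A` (two ideals `I`, `I′` with the two represented functors and the unit
  pairing) and `LocalSeesawDatum.triv_iff : D.Triv B ↔ (D.I ⊔ D.I').map (algebraMap A B) = ⊥`.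
Mathlib-only, generic (cell `hodgecm-mathlib`, M13 node N1, file S3 of the split plan; HOME certificate
`B-plan/m13-glue/N1c-LocalCore.v2.B-p01g11.lean` 056bb49165f1aeb0 = `N1-Assembly.v9` §0, decls token-identical (the unused v1 «unit trick» §1 dropped),
namespace re-homed to `Literature.RingTheory.LocalSeesaw`).

## References
* [MumfordAV1970] D. Mumford, *Abelian Varieties* (1970), §10 p. 89.
* [GortzWedhorn2023] U. Görtz, T. Wedhorn, *Algebraic Geometry II* (2023), Thm. 24.66 (p. 405; proof pp. 407–408).
* [AtiyahMacdonald1969] M. F. Atiyah, I. G. Macdonald, *Introduction to Commutative Algebra* (1969), Prop. 3.8 p. 40, Cor. 1.5 p. 4.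
-/

set_option autoImplicit false

noncomputable section

universe u

open scoped TensorProduct

namespace Literature.RingTheory.LocalSeesaw



variable {A : Type u} [CommRing A]

/-! ## §1 Units are detected at the maximal ideals -/

/-- An element that is non-zero modulo every maximal ideal is a unit. [cite: MumfordAV1970, §10 (p. 89)] -/
theorem isUnit_of_forall_maximal_image_ne_zero {B : Type u} [CommRing B] (p : B)
    (h : ∀ (𝔪 : Ideal B) [𝔪.IsMaximal], Ideal.Quotient.mk 𝔪 p ≠ 0) : IsUnit p := by
  by_contra hp
  obtain ⟨𝔪, h𝔪, hle⟩ := Ideal.exists_le_maximal (Ideal.span {p})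
    (fun htop => hp (Ideal.span_singleton_eq_top.mp htop))
  exact h 𝔪 (Ideal.Quotient.eq_zero_iff_mem.mpr (hle (Ideal.subset_span rfl)))

/-! ## §2 Linear-algebra lemmas for (H1′) -/

/-- **An ideal whose annihilator is free of rank one (linearly `≃ C`) is zero**: the generator `c₀ ↔ 1`
of the annihilator is a non-zero-divisor killed by the ideal. [cite: MumfordAV1970, §10 (p. 89)] -/
theorem Ideal.eq_bot_of_annihilator_linearEquiv {C : Type u} [CommRing C] (J : Ideal C)
    (ψ : (Submodule.annihilator (J : Submodule C C) : Ideal C) ≃ₗ[C] C) : J = ⊥ := by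
  refine eq_bot_iff.mpr fun y hy => ?_
  rw [Submodule.mem_bot]
  set c₀ := ψ.symm 1 with hc₀
  have h0 : y • c₀ = 0 := by
    apply Subtype.ext
    change y * (c₀ : C) = 0
    rw [mul_comm]
    exact Submodule.mem_annihilator.mp c₀.2 y hy
  have h1 : y • ψ c₀ = 0 := by rw [← map_smul, h0, map_zero]
  rwa [hc₀, LinearEquiv.apply_symm_apply, smul_eq_mul, mul_one] at h1

/-- **Vanishing is detected on basic opens around the maximal ideals**: if near every maximal ideal some
`D(g)` kills `J`, then `J = 0`. [cite: MumfordAV1970, §10 (p. 89)] -/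
theorem Ideal.eq_bot_of_forall_maximal_away {B : Type u} [CommRing B] (J : Ideal B)
    (h : ∀ (𝔪 : Ideal B) [𝔪.IsMaximal], ∃ g ∉ 𝔪, J.map (algebraMap B (Localization.Away g)) = ⊥) :
    J = ⊥ := by
  refine eq_bot_iff.mpr fun y hy => ?_
  rw [Submodule.mem_bot]
  -- the annihilator of `y` is contained in no maximal ideal
  let K : Ideal B := Submodule.annihilator (Submodule.span B {y})
  by_contra hy0
  have hK : K ≠ ⊤ := by
    intro hK
    have h1 : (1 : B) ∈ K := hK ▸ Submodule.mem_top
    exact hy0 (by simpa using (Submodule.mem_annihilator_span_singleton _ _).mp h1)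
  obtain ⟨𝔪, h𝔪, hK𝔪⟩ := Ideal.exists_le_maximal K hK
  obtain ⟨g, hg, hJ⟩ := h 𝔪
  have hy' : algebraMap B (Localization.Away g) y = 0 := by
    have := Ideal.mem_map_of_mem (algebraMap B (Localization.Away g)) hy
    rwa [hJ, Submodule.mem_bot] at this
  obtain ⟨⟨m, hm⟩, hmy⟩ := (IsLocalization.map_eq_zero_iff (Submonoid.powers g) _ _).mp hy'
  obtain ⟨n, rfl⟩ := hm
  have hgn : g ^ n ∈ K := (Submodule.mem_annihilator_span_singleton _ _).mpr (by simpa using hmy)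
  exact hg (h𝔪.isPrime.mem_of_pow_mem n (hK𝔪 hgn))

/-! ## §3 The local seesaw datum and the representing ideal `I + I′` -/

/-- **Local seesaw datum** on a chart `A = Γ(W, U′)` ([MumfordAV1970] §10 p. 89): the annihilator
ideals `I`, `I′` of the cyclic modules representing `H⁰(𝓕)`, `H⁰(𝓕⁻¹)`, the predicate `Triv` («`𝓕_B` is
trivialised from the base») on `A`-algebras, and the two axioms (H1′) «`Triv B` ⇒ locally
`Ann_{B_g}(I) ≃ₗ B_g`» (both ideals) and (H2′) «`I·B = 0 = I′·B` ⇒ `Triv B`». [cite: MumfordAV1970, §10 (p. 89)] -/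
structure LocalSeesawDatum (A : Type u) [CommRing A] : Type (u + 1) where
  /-- annihilator of the universal section of `𝓕` on the chart -/
  I : Ideal A
  /-- annihilator of the universal section of `𝓕⁻¹` on the chart -/
  I' : Ideal A
  /-- «`𝓕_B ≅ pr^*𝓜` for an invertible `𝓜`» -/
  Triv : ∀ (B : Type u) [CommRing B] [Algebra A B], Prop
  /-- (H1′) for `I`: a trivialised `B` has `Ann_{B_g}(I·B_g) ≃ₗ B_g` near every maximal ideal -/
  annFree_of_triv : ∀ (B : Type u) [CommRing B] [Algebra A B], Triv B →
    ∀ (𝔪 : Ideal B) [𝔪.IsMaximal], ∃ g ∉ 𝔪,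
      Nonempty ((Submodule.annihilator
        (I.map (algebraMap A (Localization.Away g)) : Submodule _ (Localization.Away g)) : Ideal _) ≃ₗ[
          Localization.Away g] Localization.Away g)
  /-- (H1′) for `I′` -/
  annFree_of_triv' : ∀ (B : Type u) [CommRing B] [Algebra A B], Triv B →
    ∀ (𝔪 : Ideal B) [𝔪.IsMaximal], ∃ g ∉ 𝔪,
      Nonempty ((Submodule.annihilator
        (I'.map (algebraMap A (Localization.Away g)) : Submodule _ (Localization.Away g)) : Ideal _) ≃ₗ[
          Localization.Away g] Localization.Away g)
  /-- (H2′) both universal sections exist ⇒ trivialised -/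
  triv_of_map_eq_bot : ∀ (B : Type u) [CommRing B] [Algebra A B],
    I.map (algebraMap A B) = ⊥ → I'.map (algebraMap A B) = ⊥ → Triv B

namespace LocalSeesawDatum

variable (D : LocalSeesawDatum A)

/-- **(⇒) If `B` is trivialised then `I + I′` dies in `B`** ((H1′) + the two lemmas of §2).
[cite: MumfordAV1970, §10 (p. 89)] -/
theorem map_eq_bot_of_triv (B : Type u) [CommRing B] [Algebra A B] (hB : D.Triv B) :
    (D.I ⊔ D.I').map (algebraMap A B) = ⊥ := by
  rw [Ideal.map_sup, sup_eq_bot_iff]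
  constructor
  · refine Ideal.eq_bot_of_forall_maximal_away _ fun 𝔪 _ => ?_
    obtain ⟨g, hg, ⟨ψ⟩⟩ := D.annFree_of_triv B hB 𝔪
    refine ⟨g, hg, ?_⟩
    rw [Ideal.map_map, ← IsScalarTower.algebraMap_eq]
    exact Ideal.eq_bot_of_annihilator_linearEquiv _ ψ
  · refine Ideal.eq_bot_of_forall_maximal_away _ fun 𝔪 _ => ?_
    obtain ⟨g, hg, ⟨ψ⟩⟩ := D.annFree_of_triv' B hB 𝔪
    refine ⟨g, hg, ?_⟩
    rw [Ideal.map_map, ← IsScalarTower.algebraMap_eq]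
    exact Ideal.eq_bot_of_annihilator_linearEquiv _ ψ

/-- **`V(I + I′)` represents «trivialised from the base» on the chart** ([MumfordAV1970] §10 p. 89):
for every `A`-algebra `B`, `Triv B ↔ (I ⊔ I′)·B = 0`. [cite: MumfordAV1970, §10 (p. 89)]
[cite: GortzWedhorn2023, Thm. 24.66, proof (pp. 407–408)] -/
theorem triv_iff (B : Type u) [CommRing B] [Algebra A B] :
    D.Triv B ↔ (D.I ⊔ D.I').map (algebraMap A B) = ⊥ :=
  ⟨D.map_eq_bot_of_triv B, fun h => by
    rw [Ideal.map_sup, sup_eq_bot_iff] at h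
    exact D.triv_of_map_eq_bot B h.1 h.2⟩

end LocalSeesawDatum


end Literature.RingTheory.LocalSeesaw

end
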